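import Literature.AlgebraicGeometry.ModuliOfAbelianVarieties.SiegelHilbertBaseWithSections
import Literature.AlgebraicGeometry.RelativeSpec.SymmetricPowerGlued
import Literature.AlgebraicGeometry.Motives.GrassmannianSchemeProper
import Mathlib.AlgebraicGeometry.Morphisms.Immersion
import HarnessLib

/-!
# Preliminaries for the Plücker class of the framed covariant over the EXPLICIT Hilbert base: compactness ∕ Noetherian chain and the
# composite classifying square (F-13 FILE A, [MumfordFogartyKirwan1994] Ch. 7 §2 Prop. 7.3–7.4)

Topic `AlgebraicGeometry/ModuliOfAbelianVarieties`, namespace `Literature.AlgebraicGeometry.ModuliOfAbelianVarieties`.  THEOREMS ONLY (no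
definition, no instance, no notation, no `sorry`).  Cell `hodgecm-mathlib` (D-0151 ∕ FLOOR 0), programme P1, sub-line F-13
`Lines/F13PluckerProducer` (skeleton v1.2, F0P1d-plan (g0) PLAN v1.1 §4 H2 ∕ §8 D4): the last stub `stub_PLofHilbertBase` (FILE B, B-p11 (g20)) reads
[MumfordFogartyKirwan1994] Prop. 7.4 (p. 135) on the covariant produced over ★ R-C1 ED. 2 §3's EXPLICIT model of the Hilbert base with
`n = 2g+1` sections (`SiegelHilbertBaseWithSections`, terms spelled as there: `H₁′ := H₁ ×_ℤ S`, `Z′ := Z_H ×_{𝐏(J;H₁)} 𝐏(J; H₁′) ⊂ 𝐏(J; H₁′)`,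
`p′ : Z′ → H₁′`, `H₀ := (Z′)ⁿ_{H₁′} = powOver p′ n`, `Z₀ := Z′ ×_{H₁′} H₀`, `i₀ : Z₀ ↪ 𝐏(J; H₀)`).  This file supplies the two consumer-shaped
preliminaries that are NOT class computations (those are ★∕HOME: P1 seed, P2a, P2b, P3, B-p11's S5 brick `FlatFamilyTwistPushforwardDetClassBaseChange`):

* §1 THE COMPACTNESS ∕ NOETHERIAN CHAIN `H₁ ↪ Gr`, `H₁′ = H₁ ×_ℤ S`, `H₀ = (Z′)ⁿ_{H₁′} → H₁′` proper, `H ↪ H₀`: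
  `compactSpace_of_isImmersion_grassmannianScheme` (a scheme immersed in the Grassmannian of a finite free `ℤ`-module is quasi-compact — ★
  `Grassmannian.isNoetherian`), `compactSpace_hilbertBaseChange` ∕ `isLocallyNoetherian_hilbertBaseChange` (`H₁′`), **`compactSpace_hilbertBase`** ∕
  **`isLocallyNoetherian_hilbertBase`** (`H₀`; ★ `RelativeSpec.isProper_powOver_base`, ★ `locallyOfFiniteType_hilbertBase`), and
  **`compactSpace_of_isImmersion_hilbertBase`** (`H` immersed in `H₀` is quasi-compact — the `CompactSpace 𝓗.H.left` field of `PL`,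
  junction J-F13-3 of the P4 sockets: not derivable from the abstract binders, only through the explicit model);
* §3 THE COMPOSITE CLASSIFYING SQUARE (shim S8 of the P4 sockets): for `jH : H → H₀`, `π : X → H`, `prH : X → Z₀` cartesian over `jH`,
  **`isPullback_comp_hilbertBaseFamily`** — `X → Z₀ → Z′ → Z_H` over `v_H := jH ≫ base ≫ q : H → H₁` is cartesian against `Z_H → H₁` (the `H` of
  B-p11's `detClass_pushforward_twistMod_comp_eq_pullback`), and **`hilbertBaseFamily_lift_comp_snd_eq`** ∕ **`comp_hilbertBaseFamily_lift_comp_snd_eq`** —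
  the structure maps to `𝐏ⁿ_ℤ` agree: `i₀ ≫ pr₂ = (Z₀ → Z′ → Z_H) ≫ iH ≫ pr₂`, so the covariant's `emb = prH ≫ i₀ ≫ pr₂` is the brick's
  `(prH ≫ Z₀ → Z′ → Z_H) ≫ iH ≫ pr₂` and `𝒪_X(d)` along `emb` IS the brick's twist (rewrite, no transport).
(§2 of the plan, the base change of `[det p_*𝒪_Z(d)]`, is B-p11 (g20)'s standalone brick; not repeated here.)

HC_CM is proved only modulo the 7 printed citations until rung 0 closes; nothing here is about HC.

## References
* [MumfordFogartyKirwan1994] D. Mumford, J. Fogarty, F. Kirwan, *Geometric Invariant Theory*, 3rd ed. (1994), Ch. 7 §2, proof of Prop. 7.3 (p. 132)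
  and Prop. 7.4 (p. 135); Ch. 0 §5 (c) (p. 23).
* [StacksProject] The Stacks Project, Tag 01NF (projective space and base change), Tag 01JA (fibre products of schemes), Tag 089T (the Grassmannian).
* [GortzWedhorn2020] U. Görtz, T. Wedhorn, *Algebraic Geometry I*, 2nd ed. (2020), (8.4) and Cor. 8.15 (p. 216); Prop. 13.47 (pp. 392–393).
-/

noncomputable section

-- `Morphisms.projectiveSpace ι S` is a `def` over Mathlib's `pullback` (as in ★ `SiegelHilbertBaseWithSections`).
set_option backward.isDefEq.respectTransparency false

open CategoryTheory CategoryTheory.Limits AlgebraicGeometry TopologicalSpace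

universe u

namespace Literature.AlgebraicGeometry.ModuliOfAbelianVarieties

open Literature.AlgebraicGeometry.Morphisms Literature.AlgebraicGeometry.RelativeSpec Literature.AlgebraicGeometry.Motives
open Literature.AlgebraicGeometry.Motives.Grassmannian

/-! ## §1 The compactness ∕ Noetherian chain -/

/-- **A scheme immersed in a quasi-compact locally Noetherian scheme is quasi-compact and locally Noetherian** — it is a subspace of a
Noetherian topological space, and an immersion is locally of finite type ([GortzWedhorn2020] Lemma 1.25, Prop. 13.47; the generic form of
★ `compactSpace_of_isImmersion`). [cite: GortzWedhorn2020, Prop. 13.47 (pp. 392–393)] -/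
theorem compactSpace_and_isLocallyNoetherian_of_isImmersion {X Y : Scheme.{u}} (f : X ⟶ Y) [IsImmersion f] [IsLocallyNoetherian Y]
    [CompactSpace Y] : CompactSpace X ∧ IsLocallyNoetherian X := by
  haveI : IsNoetherian Y := {}
  haveI : NoetherianSpace X := f.isEmbedding.isInducing.noetherianSpace
  exact ⟨inferInstance, LocallyOfFiniteType.isLocallyNoetherian f⟩

/-- **A scheme immersed in the Grassmannian of a finite free `ℤ`-module is quasi-compact** (and locally Noetherian): the Grassmannian scheme is
Noetherian (★ `Grassmannian.isNoetherian`: finitely many charts `Spec ℤ[X_I]`). [cite: GortzWedhorn2020, (8.4) and Cor. 8.15 (p. 216)]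
[cite: StacksProject, Tag 089T] -/
theorem compactSpace_of_isImmersion_grassmannianScheme (M : Type) [AddCommGroup M] (k : ℕ)
    [(grassmannianSheaf M k).obj.IsRepresentable] [Module.Finite ℤ M] [Module.Free ℤ M]
    {H₁ : Scheme.{0}} (j : H₁ ⟶ grassmannianScheme M k) [IsImmersion j] : CompactSpace H₁ := by
  haveI := Grassmannian.isLocallyNoetherian M k
  haveI := Grassmannian.compactSpace M k
  exact (compactSpace_and_isLocallyNoetherian_of_isImmersion j).1

section Explicit

variable {J : Type} {H₁ ZH : Scheme.{0}} (iH : ZH ⟶ projectiveSpace J H₁) (S : Scheme.{0}) (n : ℕ)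

/-- **`H₁′ = H₁ ×_ℤ S` is quasi-compact** when `H₁` and `S` are (`pullback.fst : H₁′ → H₁` is the base change of the quasi-compact `S → Spec ℤ`).
[cite: MumfordFogartyKirwan1994, Ch. 0 §5 (c) (p. 23)] [cite: StacksProject, Tag 01JA] -/
theorem compactSpace_hilbertBaseChange [CompactSpace H₁] [CompactSpace S] : CompactSpace ↥(pullback (terminal.from H₁) (terminal.from S)) := by
  haveI : QuasiCompact (terminal.from S) := (compactSpace_iff_quasiCompact S).mp inferInstance
  infer_instance

/-- **`H₁′ = H₁ ×_ℤ S` is locally Noetherian** when `H₁ → Spec ℤ` is locally of finite type and `S` is locally Noetherian (`pullback.snd : H₁′ → S`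
is locally of finite type, Mathlib `LocallyOfFiniteType.isLocallyNoetherian`). [cite: MumfordFogartyKirwan1994, Ch. 0 §5 (c) (p. 23)]
[cite: StacksProject, Tag 01JA] -/
theorem isLocallyNoetherian_hilbertBaseChange [LocallyOfFiniteType (terminal.from H₁)] [IsLocallyNoetherian S] :
    IsLocallyNoetherian (pullback (terminal.from H₁) (terminal.from S)) :=
  LocallyOfFiniteType.isLocallyNoetherian (pullback.snd (terminal.from H₁) (terminal.from S))

/-- **`H₀ = (Z′)ⁿ_{H₁′}` is quasi-compact**: `base : H₀ → H₁′` is proper (★ `RelativeSpec.isProper_powOver_base` for the proper `p′ : Z′ ⊂ 𝐏(J; H₁′) → H₁′`),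
hence quasi-compact, over the quasi-compact `H₁′`. [cite: MumfordFogartyKirwan1994, Ch. 7 §2, proof of Prop. 7.3 (p. 132)] [cite: StacksProject, Tag 01JA] -/
theorem compactSpace_hilbertBase [IsClosedImmersion iH] [CompactSpace H₁] [CompactSpace S] : CompactSpace ↥(powOver (pullback.snd iH (projectiveSpaceMap J (pullback.fst (terminal.from H₁) (terminal.from S))) ≫ projectiveSpaceFst J (pullback (terminal.from H₁) (terminal.from S))) n) := by
  haveI := compactSpace_hilbertBaseChange (H₁ := H₁) S
  haveI : IsProper (pullback.snd iH (projectiveSpaceMap J (pullback.fst (terminal.from H₁) (terminal.from S))) ≫ projectiveSpaceFst J (pullback (terminal.from H₁) (terminal.from S))) := inferInstance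
  haveI : IsProper (powOver.base (pullback.snd iH (projectiveSpaceMap J (pullback.fst (terminal.from H₁) (terminal.from S))) ≫ projectiveSpaceFst J (pullback (terminal.from H₁) (terminal.from S))) n) := inferInstance
  exact QuasiCompact.compactSpace_of_compactSpace (powOver.base (pullback.snd iH (projectiveSpaceMap J (pullback.fst (terminal.from H₁) (terminal.from S))) ≫ projectiveSpaceFst J (pullback (terminal.from H₁) (terminal.from S))) n)

/-- **`H₀ = (Z′)ⁿ_{H₁′}` is locally Noetherian**: `f₀ = base ≫ f₁ : H₀ → S` is locally of finite type (★ `locallyOfFiniteType_hilbertBase`) and `S` is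
locally Noetherian. [cite: MumfordFogartyKirwan1994, Ch. 7 §2, proof of Prop. 7.3 (p. 132)] [cite: StacksProject, Tag 01JA] -/
theorem isLocallyNoetherian_hilbertBase [IsClosedImmersion iH] [LocallyOfFiniteType (terminal.from H₁)] [IsLocallyNoetherian S] :
    IsLocallyNoetherian (powOver (pullback.snd iH (projectiveSpaceMap J (pullback.fst (terminal.from H₁) (terminal.from S))) ≫ projectiveSpaceFst J (pullback (terminal.from H₁) (terminal.from S))) n) :=
  haveI := locallyOfFiniteType_hilbertBase iH S n
  LocallyOfFiniteType.isLocallyNoetherian (powOver.base (pullback.snd iH (projectiveSpaceMap J (pullback.fst (terminal.from H₁) (terminal.from S))) ≫ projectiveSpaceFst J (pullback (terminal.from H₁) (terminal.from S))) n ≫ pullback.snd (terminal.from H₁) (terminal.from S))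

/-- **A scheme immersed in `H₀` is quasi-compact and locally Noetherian** — the `CompactSpace 𝓗.H.left` ∕ `IsLocallyNoetherian` of the produced covariant
(`jH : H ↪ H₀` an immersion; junction J-F13-3 of the P4 sockets), for `H₁` quasi-compact with `H₁ → Spec ℤ` locally of finite type and `S`
quasi-compact locally Noetherian (e.g. `S = Spec ℚ`, `H₁ ↪ Gr`). [cite: MumfordFogartyKirwan1994, Ch. 7 §2 Prop. 7.4 (p. 135)]
[cite: GortzWedhorn2020, Prop. 13.47 (pp. 392–393)] -/
theorem compactSpace_of_isImmersion_hilbertBase [IsClosedImmersion iH] [CompactSpace H₁] [LocallyOfFiniteType (terminal.from H₁)]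
    [CompactSpace S] [IsLocallyNoetherian S] {H : Scheme.{0}} (jH : H ⟶ powOver (pullback.snd iH (projectiveSpaceMap J (pullback.fst (terminal.from H₁) (terminal.from S))) ≫ projectiveSpaceFst J (pullback (terminal.from H₁) (terminal.from S))) n) [IsImmersion jH] :
    CompactSpace H ∧ IsLocallyNoetherian H :=
  haveI := compactSpace_hilbertBase iH S n
  haveI := isLocallyNoetherian_hilbertBase iH S n
  compactSpace_and_isLocallyNoetherian_of_isImmersion jH

/-! ## §3 The composite classifying square `X → Z₀ → Z′ → Z_H` over `v_H = jH ≫ base ≫ q`, and the structure maps to `𝐏ⁿ_ℤ` -/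

/-- **The composite square is cartesian**: for `jH : H → H₀`, `π : X → H` and `prH : X → Z₀` with `(prH, π, p₀, jH)` cartesian (the covariant's
`univ.X = Z₀ ×_{H₀} H`), the composite `X → Z₀ → Z′ → Z_H` against `Z_H ⊂ 𝐏(J; H₁) → H₁` over `v_H := jH ≫ base ≫ q : H → H₁` is cartesian
(pasting with `Z₀ = Z′ ×_{H₁′} H₀` and ★ `isPullback_hilbertFamilyBaseChange` `Z′ = Z_H ×_{H₁} H₁′`) — the square `H` consumed by the base change of
`[det p_*𝒪_{Z_H}(d)]` (B-p11 (g20) `FlatFamilyTwistPushforwardDetClassBaseChange`). [cite: MumfordFogartyKirwan1994, Ch. 7 §2, proof of Prop. 7.3 (p. 132)]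
[cite: StacksProject, Tag 01NF] -/
theorem isPullback_comp_hilbertBaseFamily {H X : Scheme.{0}} (jH : H ⟶ powOver (pullback.snd iH (projectiveSpaceMap J (pullback.fst (terminal.from H₁) (terminal.from S))) ≫ projectiveSpaceFst J (pullback (terminal.from H₁) (terminal.from S))) n) (π : X ⟶ H)
    (prH : X ⟶ pullback (pullback.snd iH (projectiveSpaceMap J (pullback.fst (terminal.from H₁) (terminal.from S))) ≫ projectiveSpaceFst J (pullback (terminal.from H₁) (terminal.from S))) (powOver.base (pullback.snd iH (projectiveSpaceMap J (pullback.fst (terminal.from H₁) (terminal.from S))) ≫ projectiveSpaceFst J (pullback (terminal.from H₁) (terminal.from S))) n))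
    (Hsq : IsPullback prH π (pullback.snd (pullback.snd iH (projectiveSpaceMap J (pullback.fst (terminal.from H₁) (terminal.from S))) ≫ projectiveSpaceFst J (pullback (terminal.from H₁) (terminal.from S))) (powOver.base (pullback.snd iH (projectiveSpaceMap J (pullback.fst (terminal.from H₁) (terminal.from S))) ≫ projectiveSpaceFst J (pullback (terminal.from H₁) (terminal.from S))) n)) jH) :
    IsPullback (prH ≫ pullback.fst (pullback.snd iH (projectiveSpaceMap J (pullback.fst (terminal.from H₁) (terminal.from S))) ≫ projectiveSpaceFst J (pullback (terminal.from H₁) (terminal.from S))) (powOver.base (pullback.snd iH (projectiveSpaceMap J (pullback.fst (terminal.from H₁) (terminal.from S))) ≫ projectiveSpaceFst J (pullback (terminal.from H₁) (terminal.from S))) n) ≫ pullback.fst iH (projectiveSpaceMap J (pullback.fst (terminal.from H₁) (terminal.from S)))) π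
      (iH ≫ projectiveSpaceFst J H₁) (jH ≫ powOver.base (pullback.snd iH (projectiveSpaceMap J (pullback.fst (terminal.from H₁) (terminal.from S))) ≫ projectiveSpaceFst J (pullback (terminal.from H₁) (terminal.from S))) n ≫ pullback.fst (terminal.from H₁) (terminal.from S)) :=
  Hsq.paste_horiz ((IsPullback.of_hasPullback (pullback.snd iH (projectiveSpaceMap J (pullback.fst (terminal.from H₁) (terminal.from S))) ≫ projectiveSpaceFst J (pullback (terminal.from H₁) (terminal.from S))) (powOver.base (pullback.snd iH (projectiveSpaceMap J (pullback.fst (terminal.from H₁) (terminal.from S))) ≫ projectiveSpaceFst J (pullback (terminal.from H₁) (terminal.from S))) n)).paste_horiz (isPullback_hilbertFamilyBaseChange iH S))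

/-- **The structure maps to `𝐏ⁿ_ℤ` agree along `Z₀ → Z′ → Z_H`**: `i₀ ≫ pr₂ = (Z₀ → Z′ → Z_H) ≫ iH ≫ pr₂` (★ `hilbertBaseFamily_lift_comp_snd`:
`i₀ ≫ pr₂ = (Z₀ → Z′) ≫ iH′ ≫ pr₂`; `iH′ ≫ pr₂ = (Z′ → Z_H) ≫ iH ≫ pr₂` by the defining square of `Z′` and ★ `projectiveSpaceMap_snd`).
[cite: MumfordFogartyKirwan1994, Ch. 7 §2, proof of Prop. 7.3 (p. 132)] [cite: StacksProject, Tag 01NF] -/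
theorem hilbertBaseFamily_lift_comp_snd_eq :
    pullback.lift (pullback.snd (pullback.snd iH (projectiveSpaceMap J (pullback.fst (terminal.from H₁) (terminal.from S))) ≫ projectiveSpaceFst J (pullback (terminal.from H₁) (terminal.from S))) (powOver.base (pullback.snd iH (projectiveSpaceMap J (pullback.fst (terminal.from H₁) (terminal.from S))) ≫ projectiveSpaceFst J (pullback (terminal.from H₁) (terminal.from S))) n)) (pullback.fst (pullback.snd iH (projectiveSpaceMap J (pullback.fst (terminal.from H₁) (terminal.from S))) ≫ projectiveSpaceFst J (pullback (terminal.from H₁) (terminal.from S))) (powOver.base (pullback.snd iH (projectiveSpaceMap J (pullback.fst (terminal.from H₁) (terminal.from S))) ≫ projectiveSpaceFst J (pullback (terminal.from H₁) (terminal.from S))) n) ≫ pullback.snd iH (projectiveSpaceMap J (pullback.fst (terminal.from H₁) (terminal.from S))) ≫ pullback.snd (terminal.from (pullback (terminal.from H₁) (terminal.from S))) (terminal.from (projectiveSpaceInt J))) (terminal.hom_ext _ _) ≫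
        pullback.snd (terminal.from (powOver (pullback.snd iH (projectiveSpaceMap J (pullback.fst (terminal.from H₁) (terminal.from S))) ≫ projectiveSpaceFst J (pullback (terminal.from H₁) (terminal.from S))) n)) (terminal.from (projectiveSpaceInt J)) =
      (pullback.fst (pullback.snd iH (projectiveSpaceMap J (pullback.fst (terminal.from H₁) (terminal.from S))) ≫ projectiveSpaceFst J (pullback (terminal.from H₁) (terminal.from S))) (powOver.base (pullback.snd iH (projectiveSpaceMap J (pullback.fst (terminal.from H₁) (terminal.from S))) ≫ projectiveSpaceFst J (pullback (terminal.from H₁) (terminal.from S))) n) ≫ pullback.fst iH (projectiveSpaceMap J (pullback.fst (terminal.from H₁) (terminal.from S)))) ≫ iH ≫ pullback.snd (terminal.from H₁) (terminal.from (projectiveSpaceInt J)) := by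
  rw [hilbertBaseFamily_lift_comp_snd iH S n, Category.assoc]
  congr 1
  rw [← projectiveSpaceMap_snd J (pullback.fst (terminal.from H₁) (terminal.from S)), ← Category.assoc, ← Category.assoc,
    pullback.condition (f := iH) (g := projectiveSpaceMap J (pullback.fst (terminal.from H₁) (terminal.from S)))]

/-- **Consumer form**: the covariant's structure map `emb = prH ≫ i₀ ≫ pr₂ : X → 𝐏ⁿ_ℤ` equals `(prH ≫ Z₀ → Z′ → Z_H) ≫ iH ≫ pr₂`, so that
`𝒪_X(d) = twistMod emb 𝒪_X d` is LITERALLY (after `rw`) the twist of the base-changed family of B-p11 (g20)'s brick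
`detClass_pushforward_twistMod_comp_eq_pullback` at the square `isPullback_comp_hilbertBaseFamily`. [cite: MumfordFogartyKirwan1994, Ch. 7 §2 Prop. 7.4 (p. 135)]
[cite: StacksProject, Tag 01NF] -/
theorem comp_hilbertBaseFamily_lift_comp_snd_eq {X : Scheme.{0}} (prH : X ⟶ pullback (pullback.snd iH (projectiveSpaceMap J (pullback.fst (terminal.from H₁) (terminal.from S))) ≫ projectiveSpaceFst J (pullback (terminal.from H₁) (terminal.from S))) (powOver.base (pullback.snd iH (projectiveSpaceMap J (pullback.fst (terminal.from H₁) (terminal.from S))) ≫ projectiveSpaceFst J (pullback (terminal.from H₁) (terminal.from S))) n)) :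
    prH ≫ pullback.lift (pullback.snd (pullback.snd iH (projectiveSpaceMap J (pullback.fst (terminal.from H₁) (terminal.from S))) ≫ projectiveSpaceFst J (pullback (terminal.from H₁) (terminal.from S))) (powOver.base (pullback.snd iH (projectiveSpaceMap J (pullback.fst (terminal.from H₁) (terminal.from S))) ≫ projectiveSpaceFst J (pullback (terminal.from H₁) (terminal.from S))) n)) (pullback.fst (pullback.snd iH (projectiveSpaceMap J (pullback.fst (terminal.from H₁) (terminal.from S))) ≫ projectiveSpaceFst J (pullback (terminal.from H₁) (terminal.from S))) (powOver.base (pullback.snd iH (projectiveSpaceMap J (pullback.fst (terminal.from H₁) (terminal.from S))) ≫ projectiveSpaceFst J (pullback (terminal.from H₁) (terminal.from S))) n) ≫ pullback.snd iH (projectiveSpaceMap J (pullback.fst (terminal.from H₁) (terminal.from S))) ≫ pullback.snd (terminal.from (pullback (terminal.from H₁) (terminal.from S))) (terminal.from (projectiveSpaceInt J))) (terminal.hom_ext _ _) ≫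
        pullback.snd (terminal.from (powOver (pullback.snd iH (projectiveSpaceMap J (pullback.fst (terminal.from H₁) (terminal.from S))) ≫ projectiveSpaceFst J (pullback (terminal.from H₁) (terminal.from S))) n)) (terminal.from (projectiveSpaceInt J)) =
      (prH ≫ pullback.fst (pullback.snd iH (projectiveSpaceMap J (pullback.fst (terminal.from H₁) (terminal.from S))) ≫ projectiveSpaceFst J (pullback (terminal.from H₁) (terminal.from S))) (powOver.base (pullback.snd iH (projectiveSpaceMap J (pullback.fst (terminal.from H₁) (terminal.from S))) ≫ projectiveSpaceFst J (pullback (terminal.from H₁) (terminal.from S))) n) ≫ pullback.fst iH (projectiveSpaceMap J (pullback.fst (terminal.from H₁) (terminal.from S)))) ≫ iH ≫ pullback.snd (terminal.from H₁) (terminal.from (projectiveSpaceInt J)) := by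
  rw [hilbertBaseFamily_lift_comp_snd_eq iH S n]
  simp only [Category.assoc]

end Explicit

end Literature.AlgebraicGeometry.ModuliOfAbelianVarieties

end
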